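import Literature.NumberTheory.EllipticCurves.TorsionFilAtCyclicOrdinaryProofs
import Literature.NumberTheory.EllipticCurves.MazurTorsionGaloisStructureProofs
import Mathlib.GroupTheory.SpecificGroups.Cyclic
import HarnessLib

/-!
# `Fil_v E[p^k] = E[p^k] ∩ E₁(K̄_v)` is cyclic as soon as ONE `p`-torsion point lies outside `Fil_v E[p]` — at ANY place,
# with no hypothesis on the reduction type (theorems only; no definition, no named fact, no instance, no `sorry`)

Topic `NumberTheory/EllipticCurves`.  Companion of `TorsionFilAtCyclicOrdinaryProofs` (cell `pub/bsd-print-x9`, D1 road, input (E1)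
of the H.4-at-`p` plan: isotropy of Howard's ordinary condition).  There, `Fil_v E[p^k]` (`WeierstrassCurve.torsionFilAt`) is proved
cyclic at a place `v ∋ p` of GOOD reduction carrying an ordinary point, by transporting the structure of the kernel of reduction of a
unit-discriminant model.  Here the SAME conclusion is obtained from the ordinary-point hypothesis ALONE — «some `P ∈ E[p]` lies outside
`Fil_v E[p]`» — by group theory inside `E[p^k] ≅ (ℤ/p^k)²`, at an arbitrary finite place `v` and with no reduction hypothesis:

* `natCard_torsionFilAt_prime_le_of_exists_not_mem` — `#Fil_v E[p] ≤ p` (a proper subgroup of the group `E[p]` of order `p²`,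
  Silverman AEC III.6.4(b) = tree `natCard_geomTorsion`);
* `natCard_torsionBy_torsionFilAt_le` — `#(Fil_v E[p^k])[p^j] ≤ p^j` for every `j` (multiplication by `p` maps the `p^{j+1}`-torsion
  to the `p^j`-torsion with kernel inside the `p`-torsion, which embeds into `Fil_v E[p]`);
* **`exists_generator_torsionFilAt_of_exists_not_mem`** — `Fil_v E[p^k]` is cyclic (Mathlib's `isAddCyclic_of_card_nsmul_eq_zero_le`:
  a finite group with at most `n` elements killed by `n`, for every `n`, is cyclic), in the binder shape of x9's
  `exists_generator_torsionFilAt` (`∃ P₀ ∈ Fil, ∀ P ∈ Fil, ∃ c : ℤ, P = c • P₀`);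
* **`pairing_torsionFilAt_eq_zero_of_exists_not_mem`** — hence every bi-additive `e` on `E[p^k]` with `e(a, a) = 0` (the Weil pairing)
  kills `Fil_v E[p^k] × Fil_v E[p^k]`: the `E`-level ISOTROPY input of Howard's H.4 at `v ∣ p` (Lemma 3.1.1), now available at places
  of MULTIPLICATIVE reduction as well (the twin `E′` of crux stmt-BirchSwinnertonDyer-24737 at `3 ∥ N′`, where `Fil_v` is the Tate line
  `μ_{3^k}`), once an ordinary point is exhibited there (division polynomial `ψ₃ ≡ b₂x³ + b₈ (mod 3)`, `3 ∤ b₂` — a separate file).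

References: R. Greenberg, LNM 1716 (1999), §1 p. 62 (`ℱ[p^∞] ≅ ℚ_p/ℤ_p`) [GreenbergLNM1716]; B. Howard, Compositio Math. 140 (2004),
§3.1 and Lemma 3.1.1 (arXiv:1202.6340 p. 15 L56–62) [Howard2004HeegnerKolyvagin]; J. H. Silverman, AEC (2009), III.6.4(b), III.8.1
[SilvermanAEC2009].  BSD is not proved by any of this.
-/

noncomputable section

open scoped Classical
open NumberField IsDedekindDomain Field

namespace WeierstrassCurve

open Literature.NumberTheory.EllipticCurves Literature.NumberTheory.GaloisRepresentations AddSubgroup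

universe u

variable {K : Type u} [Field K] [NumberField K] (W : WeierstrassCurve K) [W.IsElliptic]
  (v : HeightOneSpectrum (𝓞 K)) {p : ℕ} [hp : Fact p.Prime]

/-! ## §0 Membership in the `n`-torsion subgroup (integer `n`) -/

omit [NumberField K] [W.IsElliptic] hp in
/-- `x ∈ A[n] ↔ n • x = 0` for the additive `n`-torsion subgroup `AddSubgroup.torsionBy A n`, `n : ℤ`. [folklore] -/
private theorem mem_torsionBy_iff_zsmul_eq_zero {A : Type*} [AddCommGroup A] {n : ℤ} {x : A} :
    x ∈ torsionBy A n ↔ n • x = 0 :=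
  Submodule.mem_torsionBy_iff n x

/-! ## §1 `#Fil_v E[p] ≤ p` from one `p`-torsion point outside `Fil_v E[p]` -/

omit [NumberField K] in
/-- `E[p^k]` is finite. [cite: SilvermanAEC2009, Cor. III.6.4] -/
private theorem finite_geomTorsion_prime_pow (k : ℕ) : Finite (geomTorsion W ((p : ℤ) ^ k)) :=
  finite_torsionPoints_holds W (AlgebraicClosure K) (n := (p : ℤ) ^ k)
    (pow_ne_zero _ (by exact_mod_cast hp.out.ne_zero))

/-- **`#Fil_v E[p] ≤ p`** as soon as some `p`-torsion point of `E(K̄)` lies outside `Fil_v E[p]`: a proper subgroup of `E[p]`,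
which has `p²` elements. [cite: SilvermanAEC2009, Cor. III.6.4(b)] [cite: GreenbergLNM1716, §1 p. 62] -/
theorem natCard_torsionFilAt_prime_le_of_exists_not_mem
    (hord : ∃ P : geomTorsion W (p : ℤ), P ∉ W.torsionFilAt v (p : ℤ)) :
    Nat.card (W.torsionFilAt v (p : ℤ)) ≤ p := by
  haveI : NeZero ((p : ℕ) : K) := ⟨by exact_mod_cast hp.out.ne_zero⟩
  haveI : Finite (geomTorsion W (p : ℤ)) := by
    have h := W.finite_geomTorsion_prime_pow (p := p) 1
    rwa [pow_one] at h
  have hcard : Nat.card (geomTorsion W (p : ℤ)) = p ^ 2 := natCard_geomTorsion W p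
  -- the order of the subgroup divides `p²` and is not `p²`
  have hdvd : Nat.card (W.torsionFilAt v (p : ℤ)).toAddSubgroup ∣ p ^ 2 := by
    rw [← hcard]
    exact AddSubgroup.card_addSubgroup_dvd_card _
  obtain ⟨i, hi, hi'⟩ := (Nat.dvd_prime_pow hp.out).mp hdvd
  have hne : i ≠ 2 := by
    rintro rfl
    obtain ⟨P, hP⟩ := hord
    have htop : (W.torsionFilAt v (p : ℤ)).toAddSubgroup = ⊤ :=
      AddSubgroup.eq_top_of_card_eq _ (by rw [hi', hcard])
    exact hP (show P ∈ (W.torsionFilAt v (p : ℤ)).toAddSubgroup from htop ▸ AddSubgroup.mem_top P)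
  have hi1 : i ≤ 1 := by omega
  calc Nat.card (W.torsionFilAt v (p : ℤ)) = p ^ i := hi'
    _ ≤ p ^ 1 := Nat.pow_le_pow_right hp.out.pos hi1
    _ = p := pow_one p

/-! ## §2 `#(Fil_v E[p^k])[p^j] ≤ p^j` -/

/-- The `p`-torsion of `Fil_v E[p^k]` embeds into `Fil_v E[p]` (same points of `E(K̄)`), so it has at most `p` elements under the
ordinary-point hypothesis. [cite: GreenbergLNM1716, §1 p. 62] -/
theorem natCard_torsionBy_prime_torsionFilAt_le
    (hord : ∃ P : geomTorsion W (p : ℤ), P ∉ W.torsionFilAt v (p : ℤ)) (k : ℕ) :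
    Nat.card (torsionBy (W.torsionFilAt v ((p : ℤ) ^ k)) (p : ℤ)) ≤ p := by
  haveI : Finite (geomTorsion W (p : ℤ)) := by
    have h := W.finite_geomTorsion_prime_pow (p := p) 1
    rwa [pow_one] at h
  -- the additive map `Fil_v E[p^k] → E(K̄)`
  let ι : W.torsionFilAt v ((p : ℤ) ^ k) →+ geomPoints W :=
    (geomTorsion W ((p : ℤ) ^ k)).subtype.comp (W.torsionFilAt v ((p : ℤ) ^ k)).subtype.toAddMonoidHom
  have hι : ∀ x, ι x = ((x : geomTorsion W ((p : ℤ) ^ k)) : geomPoints W) := fun x ↦ rfl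
  have hmemp : ∀ x : torsionBy (W.torsionFilAt v ((p : ℤ) ^ k)) (p : ℤ),
      ι (x : W.torsionFilAt v ((p : ℤ) ^ k)) ∈ geomTorsion W (p : ℤ) := by
    intro x
    rw [mem_geomTorsion_iff]
    have hx : (p : ℤ) • (x : W.torsionFilAt v ((p : ℤ) ^ k)) = 0 := mem_torsionBy_iff_zsmul_eq_zero.mp x.2
    rw [← map_zsmul, hx, map_zero]
  let f : torsionBy (W.torsionFilAt v ((p : ℤ) ^ k)) (p : ℤ) → W.torsionFilAt v (p : ℤ) := fun x ↦
    ⟨⟨_, hmemp x⟩, by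
      rw [mem_torsionFilAt_iff]
      exact (W.mem_torsionFilAt_iff v _ _).mp (x : W.torsionFilAt v ((p : ℤ) ^ k)).2⟩
  have hf : Function.Injective f := by
    intro x y h
    have h' : ι (x : W.torsionFilAt v ((p : ℤ) ^ k)) = ι (y : W.torsionFilAt v ((p : ℤ) ^ k)) :=
      congrArg (fun z : W.torsionFilAt v (p : ℤ) ↦ ((z : geomTorsion W (p : ℤ)) : geomPoints W)) h
    rw [hι, hι] at h'
    exact Subtype.ext (Subtype.ext (Subtype.ext h'))
  exact (Nat.card_le_card_of_injective f hf).trans (W.natCard_torsionFilAt_prime_le_of_exists_not_mem v hord)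

/-- **`#(Fil_v E[p^k])[p^j] ≤ p^j`** for every `j`, by induction: multiplication by `p` maps the `p^{j+1}`-torsion to the
`p^j`-torsion with kernel inside the `p`-torsion. [cite: GreenbergLNM1716, §1 p. 62 (ℱ[p^k] ≅ ℤ/p^k)] -/
theorem natCard_torsionBy_torsionFilAt_le
    (hord : ∃ P : geomTorsion W (p : ℤ), P ∉ W.torsionFilAt v (p : ℤ)) (k : ℕ) :
    ∀ j : ℕ, Nat.card (torsionBy (W.torsionFilAt v ((p : ℤ) ^ k)) ((p : ℤ) ^ j)) ≤ p ^ j := by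
  haveI : Finite (geomTorsion W ((p : ℤ) ^ k)) := W.finite_geomTorsion_prime_pow k
  set G := W.torsionFilAt v ((p : ℤ) ^ k) with hG
  intro j
  induction j with
  | zero =>
    -- `G[1] = 0`
    have h0 : torsionBy G (1 : ℤ) = ⊥ := by
      rw [eq_bot_iff]
      intro x hx
      have hx' : (1 : ℤ) • x = 0 := mem_torsionBy_iff_zsmul_eq_zero.mp hx
      rw [one_smul] at hx'
      rw [hx']
      exact AddSubgroup.zero_mem _
    simp only [pow_zero]
    rw [h0, AddSubgroup.card_bot]
  | succ j ih =>
    -- `x ↦ p • x : G[p^{j+1}] → G[p^j]`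
    let f : torsionBy G ((p : ℤ) ^ (j + 1)) →+ torsionBy G ((p : ℤ) ^ j) :=
      ((DistribSMul.toAddMonoidHom G (p : ℤ)).comp (torsionBy G ((p : ℤ) ^ (j + 1))).subtype).codRestrict
        (torsionBy G ((p : ℤ) ^ j)) (fun x ↦ by
          have hx : ((p : ℤ) ^ (j + 1)) • (x : G) = 0 := mem_torsionBy_iff_zsmul_eq_zero.mp x.2
          apply mem_torsionBy_iff_zsmul_eq_zero.mpr
          show ((p : ℤ) ^ j) • ((p : ℤ) • (x : G)) = 0
          rw [smul_smul, ← pow_succ, hx])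
    have hfapply : ∀ x, ((f x : torsionBy G ((p : ℤ) ^ j)) : G) = (p : ℤ) • (x : G) := fun x ↦ rfl
    -- its kernel lies in `G[p]`
    have hker : Nat.card f.ker ≤ p := by
      have hk0 : ∀ x : f.ker, (p : ℤ) • (((x : torsionBy G ((p : ℤ) ^ (j + 1))) : G)) = 0 := fun x ↦ by
        rw [← hfapply]
        have hx : f x = 0 := (AddMonoidHom.mem_ker).mp x.2
        rw [hx]
        rfl
      let g : f.ker → torsionBy G (p : ℤ) := fun x ↦
        ⟨((x : torsionBy G ((p : ℤ) ^ (j + 1))) : G), mem_torsionBy_iff_zsmul_eq_zero.mpr (hk0 x)⟩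
      have hg : Function.Injective g := by
        intro x y h
        apply Subtype.ext; apply Subtype.ext
        exact congrArg (fun z : torsionBy G (p : ℤ) ↦ (z : G)) h
      exact (Nat.card_le_card_of_injective g hg).trans (W.natCard_torsionBy_prime_torsionFilAt_le v hord k)
    have hrange : Nat.card f.range ≤ p ^ j := (AddSubgroup.card_le_card_addGroup f.range).trans ih
    calc Nat.card (torsionBy G ((p : ℤ) ^ (j + 1))) = Nat.card f.ker * f.ker.index :=
          (AddSubgroup.card_mul_index f.ker).symm
      _ = Nat.card f.ker * Nat.card f.range := by rw [AddSubgroup.index_ker]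
      _ ≤ p * p ^ j := Nat.mul_le_mul hker hrange
      _ = p ^ (j + 1) := by ring

/-! ## §3 Cyclicity and isotropy -/

/-- **`Fil_v E[p^k]` is cyclic from one ordinary point**, at any finite place `v` and with no reduction hypothesis: there is
`P₀ ∈ torsionFilAt W v (p^k)` of which every element of `torsionFilAt W v (p^k)` is an integer multiple — the binder shape of x9's
`exists_generator_torsionFilAt` (which assumes good reduction at `v ∋ p`). [cite: GreenbergLNM1716, §1 p. 62 (ℱ[p^k] cyclic)]
[cite: Howard2004HeegnerKolyvagin, §3.1 (arXiv p. 15, L56–62: Fil_v T has rank one)] -/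
theorem exists_generator_torsionFilAt_of_exists_not_mem
    (hord : ∃ P : geomTorsion W (p : ℤ), P ∉ W.torsionFilAt v (p : ℤ)) (k : ℕ) :
    ∃ P₀ ∈ W.torsionFilAt v ((p : ℤ) ^ k), ∀ P ∈ W.torsionFilAt v ((p : ℤ) ^ k), ∃ c : ℤ, P = c • P₀ := by
  haveI : Finite (geomTorsion W ((p : ℤ) ^ k)) := W.finite_geomTorsion_prime_pow k
  set G := W.torsionFilAt v ((p : ℤ) ^ k) with hG
  haveI : Finite G := inferInstance
  letI : Fintype G := Fintype.ofFinite G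
  -- every element of `G` is killed by `p^k`
  let ι : G →+ geomPoints W := (geomTorsion W ((p : ℤ) ^ k)).subtype.comp G.subtype.toAddMonoidHom
  have hιinj : Function.Injective ι := fun x y h ↦ Subtype.ext (Subtype.ext h)
  have hkill : ∀ x : G, ((p : ℤ) ^ k) • x = 0 := fun x ↦ by
    apply hιinj
    rw [map_zsmul, map_zero]
    exact (mem_geomTorsion_iff W _ _).mp (x : geomTorsion W ((p : ℤ) ^ k)).2
  -- at most `n` elements killed by `n`, for every `n > 0`
  have hn : ∀ n : ℕ, 0 < n → (Finset.univ.filter fun a : G ↦ n • a = 0).card ≤ n := by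
    intro n hn0
    obtain ⟨j, -, hj⟩ := (Nat.dvd_prime_pow hp.out).mp (Nat.gcd_dvd_right n (p ^ k))
    have hdn : Nat.gcd n (p ^ k) ≤ n := Nat.gcd_le_left (p ^ k) hn0
    -- `{a | n • a = 0} ⊆ G[gcd(n, p^k)] = G[p^j]` (Bézout)
    have hsub : ∀ a : G, n • a = 0 → ((p : ℤ) ^ j) • a = 0 := fun a ha ↦ by
      have h1 : ((Nat.gcd n (p ^ k) : ℕ) : ℤ) • a = 0 := by
        rw [Nat.gcd_eq_gcd_ab n (p ^ k), add_smul, mul_comm (n : ℤ) (Nat.gcdA n (p ^ k)), mul_smul, natCast_zsmul,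
          ha, smul_zero, zero_add, mul_comm ((p ^ k : ℕ) : ℤ) (Nat.gcdB n (p ^ k)), mul_smul, Nat.cast_pow, hkill,
          smul_zero]
      rwa [hj, Nat.cast_pow] at h1
    rw [← Nat.subtype_card (p := fun a : G ↦ n • a = 0) (Finset.univ.filter fun a : G ↦ n • a = 0)
      (fun x ↦ by simp only [Finset.mem_filter, Finset.mem_univ, true_and])]
    let e : {a : G // n • a = 0} → torsionBy G ((p : ℤ) ^ j) := fun a ↦
      ⟨a.1, mem_torsionBy_iff_zsmul_eq_zero.mpr (hsub a.1 a.2)⟩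
    have he : Function.Injective e := fun a b h ↦
      Subtype.ext (congrArg (fun z : torsionBy G ((p : ℤ) ^ j) ↦ (z : G)) h)
    calc Nat.card {a : G // n • a = 0} ≤ Nat.card (torsionBy G ((p : ℤ) ^ j)) := Nat.card_le_card_of_injective e he
      _ ≤ p ^ j := W.natCard_torsionBy_torsionFilAt_le v hord k j
      _ = Nat.gcd n (p ^ k) := hj.symm
      _ ≤ n := hdn
  haveI : IsAddCyclic G := isAddCyclic_of_card_nsmul_eq_zero_le hn
  obtain ⟨g, hg⟩ := IsAddCyclic.exists_generator (α := G)
  refine ⟨(g : geomTorsion W ((p : ℤ) ^ k)), g.2, fun P hP ↦ ?_⟩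
  obtain ⟨n, hn'⟩ := AddSubgroup.mem_zmultiples_iff.mp (hg ⟨P, hP⟩)
  exact ⟨n, by rw [← Submodule.coe_smul_of_tower, hn']⟩

/-- **`Fil_v E[p^k]` is isotropic for every bi-additive `e` on `E[p^k]` with `e(a, a) = 0`** (the Weil pairing), from one ordinary
point and at any place: the `E`-level input of the isotropy of Howard's ordinary / Tate-line condition at `v ∣ p` (Lemma 3.1.1).
[cite: Howard2004HeegnerKolyvagin, Lemma 3.1.1 (arXiv p. 15, L60–62)] [cite: SilvermanAEC2009, Prop. III.8.1 (e_m alternating)] -/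
theorem pairing_torsionFilAt_eq_zero_of_exists_not_mem {P : Type*} [AddCommGroup P]
    (hord : ∃ Q : geomTorsion W (p : ℤ), Q ∉ W.torsionFilAt v (p : ℤ)) (k : ℕ)
    (e : geomTorsion W ((p : ℤ) ^ k) →+ geomTorsion W ((p : ℤ) ^ k) →+ P) (hself : ∀ a, e a a = 0) :
    ∀ a ∈ W.torsionFilAt v ((p : ℤ) ^ k), ∀ b ∈ W.torsionFilAt v ((p : ℤ) ^ k), e a b = 0 := by
  obtain ⟨P₀, -, hP₀⟩ := W.exists_generator_torsionFilAt_of_exists_not_mem v hord k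
  intro a ha b hb
  obtain ⟨c, rfl⟩ := hP₀ a ha
  obtain ⟨d, rfl⟩ := hP₀ b hb
  have h1 : e (c • P₀) P₀ = 0 := by
    rw [← AddMonoidHom.flip_apply e, map_zsmul, AddMonoidHom.flip_apply, hself, zsmul_zero]
  rw [map_zsmul, h1, zsmul_zero]

end WeierstrassCurve

end
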